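/-
Copyright: lit-balaban Phase-2 proof seat p08 (gen 7).  Statement-level skeleton of a published paper; no proof claims beyond what
the kernel checks below.
-/
import Literature.MathematicalPhysics.QuantumFieldTheory.BalabanImbrieJaffe1984to88.BIJ88Ineq217GradKernel
import Literature.MathematicalPhysics.QuantumFieldTheory.BalabanImbrieJaffe1984to88.BIJ85Eq721MinimizerKernel

/-!
# `BalabanImbrieJaffe1984to88.BIJ88Ineq217Ineq722Torus` — T. Bałaban, J. Imbrie, A. Jaffe, *Effective action and cluster properties of
the abelian Higgs model*, Commun. Math. Phys. **114** (1988) 257–315 [BalabanImbrieJaffe1988]: **(2.17)** p. 262 on the torus with its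
near-part input supplied BY THE TYPED ROW C1.Eq7.2.1-7.2.2 of [I] = [BalabanImbrieJaffe1985] — the kernel hypothesis `hK` of gen 7's
`BIJ88Ineq217GradKernel.abs_ineq217_gradKernel_torus_eta` (`|∂^{η⁻¹}H_k(p; b)| ≤ Me^{−δ|x_k(p) − b₋|}`) is DERIVED from r15's typed display
`BIJ85Sect7Statements.KernelData.Ineq722` for the torus kernel family of p09's `BIJ85Ineq722Torus.torusKernelData` (for which (7.2.2) is
the tree's `BIJ85Ineq722DeltaA.ineq722_deltaA_of_prop12Printed`, i.e. holds given only [6I] Proposition 1.2 by its tree name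
`B5.Prop12Printed`), through p09's (7.2.1) `BIJ85Eq721MinimizerKernel.eq721_applyKernel` (the kernel of that carrier IS the integral kernel
of the Landau minimizer `H_k` = p11's `HkE`); so that (2.17) holds on every torus of the series, with ONE constant for all scales, given
exactly: (2.16) for σ_k (displayed) and [6I] Proposition 1.2 (by name)

statement-level skeleton of published theorems with citation tags; proofs where landed; nothing here is a claim about the Yang–Mills mass gap

PDF held: `paper:balaban1988-cmp114-bij-abelian-higgs-effective-action` (journal page = PDF page + 256), p. 262 [PDF 6]; [I] =
[BalabanImbrieJaffe1985] (`paper:balaban1985-cmp97-bij-higgs-minimizers`, journal page = PDF page + 298) p. 325 [PDF 27] (text layers read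
in gen 7).

CITATION HEADER (lean-in-tree rule).  Part of the lit-balaban TYPED SKELETON (HOME `run/shared/lean/pub/lit-balaban/`), Phase-2 proof
seat p08 (gen 7), unit `lit-balaban-p08`; WHAT IS REPRODUCED = SKELETON row **C2.Eq2.17** (owner r18, referee ref-5), kind «model
instance» for the torus σ_k, joined to row **C1.Eq7.2.1-7.2.2** (owner r15; typed `KernelData.Ineq722` p239582, torus instance proved
given [6I] Prop. 1.2: p09's files `BIJ85Ineq722Torus`/`BIJ85Ineq722DeltaA`/`BIJ85Eq721MinimizerKernel`); companion of
`BIJ88Ineq217GradKernel` (p257837) and `BIJ88Ineq217LandauTorus` (p257207).  TAKING line HOME/STATUS.md (gen 7, eighth target).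

THE PRINTED TEXT.  C2 p. 262 [PDF 6], verbatim: *"Furthermore, (σ_kf^{(k)})(p₁) ≦ ‖f^{(k)}‖_∞, (2.17) if f^{(k)} has the form f^{(k)} = ∂A
in a neighborhood of p₁. To see this, write f^{(k)} = ∂□A + f′, where □ is the characteristic function of a neighborhood of p₁. The
contribution to (2.17) from the distant part of f′ is bounded by (2.16). The near part is similarly bounded since σ_k is a bounded
operator on curls [2]."*  [I] p. 325 [PDF 27], verbatim: *"The minimizer H_k can be expressed as an integral kernel. For x ∈ T_η,
(H_kB)_μ(x) = Σ_{y∈T₁^{(k)},ν} H_{k,μν}(x; y)B_ν(y). (7.2.1) The kernel H_{k,μν}(x,y) and its gradient decay exponentially. In particular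
there exists δ > 0 and for 0 ≦ α < 1 a constant M = M(α) < ∞ such that for |x − x′| ≦ 1, |H_{k,μν}(x,y)| + |∇H_{k,μν}(x,y)| +
|x − x′|^{−α}|∇H_{k,μν}(x,y) − ∇H_{k,μν}(x′,y)| ≦ Me^{−δ|x−y|}. (7.2.2) This inequality is a consequence of Proposition 1.2 and the
representation (1.103) of [6I]."*

THE TORUS DATA (all in the tree): p11's Landau minimizer `H_k = HkE P w c k` (= `BIJ85LandauMinimizer442.Hk (opsV1 P k c √w)`,
`HkE_apply`); p09's Sect. 7.2 carrier `torusKernelData P k (deltaAData hk a) …` of the representation (1.103) for the printed `G = Δ_a⁻¹`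
(kernel `H_{k,μν}(x; y) = (torusRep P k (deltaAData hk a)).H (x,μ) (y,ν)`, `|∇H_{k,μν}(x, y)| = max_λ|L^k(H_{k,μν}(x + ηe_λ; y) −
H_{k,μν}(x; y))|` (`torusKernelData_gradH`), fine-site distance `|x − y| = distEU P k x y = |x − ctr y|_∞/L^k`), the typed display
`KernelData.Ineq722`, the block map `x_k = blk k x` ((I.5.1.2)), the `ℓ¹` torus distance `tdist` of `T^{(k)}`.

WHAT IS PROVED (0 `sorry`, standard axioms; theorems only — proof lane):
* §1 **the kernel of `B ↦ H_kB` for p11's `HkE` IS `H_{k,μν}(x; y)`**: `ofLp_HkE_single` — `(H_ke_b)_κ(z) = H_{k,κν}(z; y)`, `b = ⟨y, ν⟩`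
  ((7.2.1) `eq721_applyKernel` at the unit field `e_b`; any `w > 0`, `c ≠ 0`; independent of both).
* §2 **`∂^{c′}` of the column is a difference of two gradient components**: `curl_HkE_single_eq` — `(∂^{c′}H_ke_b)(p) = c′(H_{k,νλ}(x + e_μ; y) −
  H_{k,νλ}(x; y)) − c′(H_{k,μλ}(x + e_ν; y) − H_{k,μλ}(x; y))`, `p = (x; μ < ν)`, `b = ⟨y, λ⟩`; hence at `c′ = η⁻¹ = L^k`
  `|(∂^{η⁻¹}H_ke_b)(p)| ≤ |∇H_{k,νλ}(x, y)| + |∇H_{k,μλ}(x, y)|` (`abs_curl_HkE_single_le_gradH`, the `|∇H|` member of p09's carrier).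
* §3 **the typed (7.2.2) read at `α = 0`**: `exists_bound_of_ineq722` — from `KernelData.Ineq722` for the torus family `j ↦ torusKernelData P
  (lev j) …`: `∃ δ > 0, M ≥ 0, ∀ j μ ν x y, |H_{k,μν}(x; y)| + |∇H_{k,μν}(x, y)| ≤ Me^{−δ|x − y|}` (the printed side condition `|x − x′| ≤ 1`
  is met by `x′ = x + ηe_μ ≠ x` on every torus of the series; the Hölder member is `≥ 0`).
* §4 **the kernel hypothesis `hK` of `BIJ88Ineq217GradKernel`** from such bounds: `hK_of_kernelBounds` — `|(∂^{η⁻¹}H_ke_b)(p)| ≤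
  2Me^{δ/2}·e^{−(δ/d)|x_k(p) − b₋|₁}` (`|x_k − y|₁ ≤ d|x_k − y|_∞ ≤ d(|x − y| + ½)`, `BIJ85Ineq724Torus.supDist_blk_le_distEU`,
  `B3TorusRadialSums.tdist_le_mul_supDist`); `exists_hK_of_ineq722` (for all scales of the family at once).
* §5 **(2.17) ON THE TORI FROM (2.16) AND THE TYPED (7.2.2)**: `abs_ineq217_kernelBounds_torus` (one scale, explicit constants),
  **`abs_ineq217_ineq722_torus`** — given `KernelData.Ineq722` for the torus kernel family there is ONE constant `C₁ ≥ 0` such that at every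
  scale `k = lev j ≤ m + K` of the family, for p30's `σ_k = sigmaTorus hd η^d η⁻¹ k`, every `f = ∂A` on the box of radius `R` about `p₁` and
  (2.16) for the kernel of σ_k beyond `R` (constant `c₀`, rate `δ`, row sum `S`): `|(σ_kf)(p₁)| ≤ (C₁(d−1)2R + c₀S(1 + 8(d−1)R))·‖f‖_∞` — and
  **`abs_ineq217_prop12_torus`**: the same given only [6I] Proposition 1.2 by its tree name `B5.Prop12Printed` for the torus carriers
  (`BIJ85Ineq722DeltaA.ineq722_deltaA_of_prop12Printed`).
HONEST SCOPE.  (i) (2.16) for the concrete σ_k stays a displayed hypothesis (row C2.Eq2.16, by reference to [2]); [6I] Proposition 1.2 enters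
by name exactly as in row C1.Eq7.2.1-7.2.2's own files.  (ii) Constants explicit, not print's `1`; `U = 1` real abelian fields; torus
(periodic b.c.); standing range.  (iii) No `def`, no new named fact, nothing restated: theorems only; NOT summit progress.
Unit `lit-balaban-p08` (literature-prover-lit-balaban-p08-g7-0), 2026-08-21.
-/

open scoped BigOperators RealInnerProductSpace

namespace Literature.MathematicalPhysics.QuantumFieldTheory.BalabanImbrieJaffe1984to88.BIJ88Ineq217Ineq722Torus

open Balaban1983to89 hiding Site Plaq
open Balaban1983to89.LatticeFieldCalculus Balaban1983to89.T4AxialGaugeSmallField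
open Balaban1983to89.B3TorusRadialSums (tdist_le_mul_supDist)
open BIJ88Sect2Statements BIJ88Close235Proof BIJ88Ineq217Mechanism BIJ88Ineq217NearPart BIJ88Ineq217Torus BIJ88Ineq217SigmaTorus
  BIJ88Ineq217LandauTorus BIJ88Ineq217GradKernel
open BIJ85AxialPropagator411 BIJ85Prop521Torus BIJ85Sigma421Torus BIJ85Eq611Torus BIJ85Prop522Torus BIJ85Sigma422Eta
open BIJ85LandauMinimizer442 BIJ85LandauMinimizer442V1
open BIJ85Sect7Statements BIJ85Ineq722Torus BIJ85Eq721MinimizerKernel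
open BIJ85Ineq722ProofPart2 (settingOf)
open BIJ85Ineq722DeltaA (deltaAData ineq722_deltaA_of_prop12Printed)
open BIJ85Ineq724Proof (applyKernel)
open BIJ85Ineq724Torus (supDist_blk_le_distEU)
open BIJ85GaugeFunction5113 (blk)
-- inside this namespace the bare `Site`/`Plaq` are the `ℤ^d` carriers of the QFT root; the torus ones are renamed:
open Balaban1983to89 renaming Site → TSite, Plaq → TPlaq

noncomputable section

variable {P : Params}

/-! ## §0  Torus bookkeeping -/

/-- `x + e_μ ≠ x` on every torus of the series (`1 ≠ 0` in `ZMod (2L^{m+K−j})`). [folklore] -/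
private theorem shift_ne_self' {j : ℕ} (x : TSite P j) (μ : Fin P.d) : x.shift μ ≠ x := by
  intro h
  have h1 := congrFun h μ
  simp only [Balaban1983to89.Site.shift, Function.update_self] at h1
  exact one_ne_zero (add_eq_left.1 h1)

/-- `|x − (x + e_μ)|_∞ ≤ 1`. [folklore] -/
private theorem supDist_shift_le {j : ℕ} (x : TSite P j) (μ : Fin P.d) : supDist x (x.shift μ) ≤ 1 := by
  have h := supDist_runSite_le x μ 1
  have h2 : runSite x μ 1 = x.shift μ := by
    show Function.update x μ (x μ + ((1 : ℕ) : ZMod _)) = Function.update x μ (x μ + 1)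
    rw [Nat.cast_one]
  rwa [h2] at h

/-- unfolding: the `|x − x′|` member of p09's torus carrier is `|x − x′|_∞/L^k` (`torusRep.dS`). [cite: BalabanImbrieJaffe1985, (7.2.2) p.325] -/
theorem torusKernelData_distEta {k : ℕ} (D : TorusData P k) (BondU : Type) (distEB : TSite P 0 → BondU → ℝ)
    (Cker : Fin P.d → Fin P.d → TSite P k → TSite P k → ℝ) (Dker : TSite P 0 → BondU → ℝ) (x x' : TSite P 0) :
    (torusKernelData P k D BondU distEB Cker Dker).distEta x x' = (torusRep P k D).dS x x' := rfl

/-- unfolding: the `|x − y|` member of p09's torus carrier is the fine-site distance `distEU`. [cite: BalabanImbrieJaffe1985, (7.2.2) p.325] -/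
theorem torusKernelData_distEU {k : ℕ} (D : TorusData P k) (BondU : Type) (distEB : TSite P 0 → BondU → ℝ)
    (Cker : Fin P.d → Fin P.d → TSite P k → TSite P k → ℝ) (Dker : TSite P 0 → BondU → ℝ) (x : TSite P 0) (y : TSite P k) :
    (torusKernelData P k D BondU distEB Cker Dker).distEU x y = distEU P k x y := rfl

/-- the `|∇H|` member of p09's torus carrier is a sup norm, hence `≥ 0`. [cite: BalabanImbrieJaffe1985, (7.2.2) p.325] -/
theorem torusKernelData_gradH_nonneg {k : ℕ} {D : TorusData P k} {BondU : Type} {distEB : TSite P 0 → BondU → ℝ}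
    {Cker : Fin P.d → Fin P.d → TSite P k → TSite P k → ℝ} {Dker : TSite P 0 → BondU → ℝ} {μ ν : Fin P.d} {x : TSite P 0}
    {y : TSite P k} : 0 ≤ (torusKernelData P k D BondU distEB Cker Dker).gradH μ ν x y :=
  norm_nonneg _

/-- the Hölder member `|∇H(x, y) − ∇H(x′, y)|` of p09's torus carrier is a sup norm, hence `≥ 0`. [cite: BalabanImbrieJaffe1985, (7.2.2) p.325] -/
theorem torusKernelData_gradHDiff_nonneg {k : ℕ} {D : TorusData P k} {BondU : Type} {distEB : TSite P 0 → BondU → ℝ}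
    {Cker : Fin P.d → Fin P.d → TSite P k → TSite P k → ℝ} {Dker : TSite P 0 → BondU → ℝ} {μ ν : Fin P.d} {x x' : TSite P 0}
    {y : TSite P k} : 0 ≤ (torusKernelData P k D BondU distEB Cker Dker).gradHDiff μ ν x x' y :=
  norm_nonneg _

/-! ## §1  The kernel of p11's `HkE` is the (7.2.1) kernel `H_{k,μν}(x; y)` -/

/-- **the column of `H_k` at the unit bond `b = ⟨y, ν⟩` is `H_{k,·ν}(·; y)`**: `(H_ke_b)_κ(z) = H_{k,κν}(z; y)` for p11's Landau minimizer
`HkE P w c k` (any `w > 0`, `c ≠ 0`) and the kernel of p09's torus carrier for the printed `G = Δ_a⁻¹` (any `a > 0`) — (7.2.1)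
(`BIJ85Eq721MinimizerKernel.eq721_applyKernel`) at `B = e_b`. [cite: BalabanImbrieJaffe1985, (7.2.1) p.325] -/
theorem ofLp_HkE_single {k : ℕ} (hk : k ≤ P.m + P.K) {c : ℝ} (hc : c ≠ 0) {w : ℝ} (hw : 0 < w) {a : ℝ} (ha : 0 < a)
    (b : PBond P k) (z : TSite P 0) (κ : Fin P.d) :
    WithLp.ofLp (HkE P w c k (toEj P k (Pi.single b 1))) ⟨z, κ⟩ =
      (torusRep P k (deltaAData hk a)).H (z, κ) (b.src, b.dir) := by
  have hs : Real.sqrt w ≠ 0 := (Real.sqrt_pos.2 hw).ne'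
  rw [HkE_apply hk hc hw]
  show Hk (opsV1 P k c (Real.sqrt w)) (Pi.single b 1) ⟨z, κ⟩ = _
  rw [eq721_applyKernel hk ha hc hs]
  unfold applyKernel
  rw [Finset.sum_eq_single b]
  · rw [Pi.single_eq_same, mul_one]
  · intro b' _ hb'
    rw [Pi.single_eq_of_ne hb', mul_zero]
  · intro h; exact absurd (Finset.mem_univ b) h

/-! ## §2  `∂^{c′}` of the column: a difference of two gradient components -/

/-- **`(∂^{c′}H_ke_b)(p) = c′(H_{k,νλ}(x + e_μ; y) − H_{k,νλ}(x; y)) − c′(H_{k,μλ}(x + e_ν; y) − H_{k,μλ}(x; y))`** for `p = (x; μ < ν)`,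
`b = ⟨y, λ⟩` (the curl (I.1.2) `(∂A)(p) = (∂_μA_ν)(x) − (∂_νA_μ)(x)` of the column §1). [cite: BalabanImbrieJaffe1985, (7.2.1) p.325] -/
theorem curl_HkE_single_eq {k : ℕ} (hk : k ≤ P.m + P.K) {c : ℝ} (hc : c ≠ 0) {w : ℝ} (hw : 0 < w) {a : ℝ} (ha : 0 < a)
    (c' : ℝ) (b : PBond P k) (p : TPlaq P 0) :
    curl c' (WithLp.ofLp (HkE P w c k (toEj P k (Pi.single b 1)))) p =
      c' * ((torusRep P k (deltaAData hk a)).H (p.src.shift p.μ, p.ν) (b.src, b.dir) -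
          (torusRep P k (deltaAData hk a)).H (p.src, p.ν) (b.src, b.dir)) -
        c' * ((torusRep P k (deltaAData hk a)).H (p.src.shift p.ν, p.μ) (b.src, b.dir) -
          (torusRep P k (deltaAData hk a)).H (p.src, p.μ) (b.src, b.dir)) := by
  simp only [curl, ofLp_HkE_single hk hc hw ha, smul_eq_mul]
  ring

/-- **`|(∂^{η⁻¹}H_ke_b)(p)| ≤ |∇H_{k,νλ}(x, y)| + |∇H_{k,μλ}(x, y)|`** (`η⁻¹ = L^k`; `p = (x; μ < ν)`, `b = ⟨y, λ⟩`): each bracket of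
`curl_HkE_single_eq` is one component `λ′ = μ` (resp. `ν`) of the forward difference quotient `∇H_{k,·λ}(x, y)`, bounded by the `|∇H|`
member `max_{λ′}|∇_{λ′}H|` of p09's Sect. 7.2 carrier (`torusKernelData_gradH`). [cite: BalabanImbrieJaffe1985, (7.2.2) p.325] -/
theorem abs_curl_HkE_single_le_gradH {k : ℕ} (hk : k ≤ P.m + P.K) {c : ℝ} (hc : c ≠ 0) {w : ℝ} (hw : 0 < w) {a : ℝ} (ha : 0 < a)
    (BondU : Type) (distEB : TSite P 0 → BondU → ℝ) (Cker : Fin P.d → Fin P.d → TSite P k → TSite P k → ℝ)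
    (Dker : TSite P 0 → BondU → ℝ) (b : PBond P k) (p : TPlaq P 0) :
    |curl ((P.L : ℝ) ^ k) (WithLp.ofLp (HkE P w c k (toEj P k (Pi.single b 1)))) p| ≤
      (torusKernelData P k (deltaAData hk a) BondU distEB Cker Dker).gradH p.ν b.dir p.src b.src +
        (torusKernelData P k (deltaAData hk a) BondU distEB Cker Dker).gradH p.μ b.dir p.src b.src := by
  rw [curl_HkE_single_eq hk hc hw ha, torusKernelData_gradH, torusKernelData_gradH]
  refine (abs_sub _ _).trans (add_le_add ?_ ?_)
  · have h := norm_le_pi_norm (fun lam : Fin P.d => (P.L : ℝ) ^ k *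
      ((torusRep P k (deltaAData hk a)).H (p.src.shift lam, p.ν) (b.src, b.dir) -
        (torusRep P k (deltaAData hk a)).H (p.src, p.ν) (b.src, b.dir))) p.μ
    rw [Real.norm_eq_abs] at h
    exact h
  · have h := norm_le_pi_norm (fun lam : Fin P.d => (P.L : ℝ) ^ k *
      ((torusRep P k (deltaAData hk a)).H (p.src.shift lam, p.μ) (b.src, b.dir) -
        (torusRep P k (deltaAData hk a)).H (p.src, p.μ) (b.src, b.dir))) p.ν
    rw [Real.norm_eq_abs] at h
    exact h

/-! ## §3  The typed (7.2.2) read at `α = 0` -/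

/-- **(7.2.2) for the torus kernel family, the `|H| + |∇H|` members**: from r15's typed display `KernelData.Ineq722` for the family
`j ↦ torusKernelData P (lev j) (deltaAData …) …` (scales `lev j ≤ m + K`): `∃ δ > 0, M ≥ 0` with `|H_{k,μν}(x; y)| + |∇H_{k,μν}(x, y)| ≤
Me^{−δ|x − y|}` at every scale of the family — the display at `α = 0`, its side condition `|x − x′| ≤ 1`, `x ≠ x′` met by `x′ = x + ηe_μ`
(every torus of the series has at least two sites per direction), its Hölder member dropped (`≥ 0`). [cite: BalabanImbrieJaffe1985, (7.2.2) p.325] -/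
theorem exists_bound_of_ineq722 {lev : ℕ → ℕ} (hlev : ∀ j, lev j ≤ P.m + P.K) {a : ℝ} {BondU : ℕ → Type}
    {distEB : (j : ℕ) → TSite P 0 → BondU j → ℝ} {Cker : (j : ℕ) → Fin P.d → Fin P.d → TSite P (lev j) → TSite P (lev j) → ℝ}
    {Dker : (j : ℕ) → TSite P 0 → BondU j → ℝ}
    (h722 : KernelData.Ineq722
      (fun j => torusKernelData P (lev j) (deltaAData (hlev j) a) (BondU j) (distEB j) (Cker j) (Dker j))) :
    ∃ δ M : ℝ, 0 < δ ∧ 0 ≤ M ∧ ∀ (j : ℕ) (μ ν : Fin P.d) (x : TSite P 0) (y : TSite P (lev j)),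
      |(torusRep P (lev j) (deltaAData (hlev j) a)).H (x, μ) (y, ν)| +
          (torusKernelData P (lev j) (deltaAData (hlev j) a) (BondU j) (distEB j) (Cker j) (Dker j)).gradH μ ν x y ≤
        M * Real.exp (-(δ * distEU P (lev j) x y)) := by
  obtain ⟨δ, hδ, hα⟩ := h722
  obtain ⟨M, hM⟩ := hα 0 le_rfl zero_lt_one
  have hL1 : (1 : ℝ) ≤ (P.L : ℝ) := by exact_mod_cast P.L_pos
  have key : ∀ (j : ℕ) (μ ν : Fin P.d) (x : TSite P 0) (y : TSite P (lev j)),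
      |(torusRep P (lev j) (deltaAData (hlev j) a)).H (x, μ) (y, ν)| +
          (torusKernelData P (lev j) (deltaAData (hlev j) a) (BondU j) (distEB j) (Cker j) (Dker j)).gradH μ ν x y ≤
        M * Real.exp (-(δ * distEU P (lev j) x y)) := by
    intro j μ ν x y
    have hne : x ≠ x.shift μ := (shift_ne_self' x μ).symm
    have hle : (torusKernelData P (lev j) (deltaAData (hlev j) a) (BondU j) (distEB j) (Cker j) (Dker j)).distEta
        x (x.shift μ) ≤ 1 := by
      rw [torusKernelData_distEta, dS_le_iff, one_mul]
      have h1 : (supDist x (x.shift μ) : ℝ) ≤ 1 := by exact_mod_cast supDist_shift_le x μ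
      exact h1.trans (one_le_pow₀ hL1)
    have h := hM j μ ν x (x.shift μ) y hne hle
    rw [neg_zero, Real.rpow_zero, one_mul, torusKernelData_H, torusKernelData_distEU] at h
    exact (le_add_of_nonneg_right torusKernelData_gradHDiff_nonneg).trans h
  have hM0 : 0 ≤ M :=
    (mul_nonneg_iff_of_pos_right (Real.exp_pos _)).1
      (le_trans (add_nonneg (abs_nonneg _) torusKernelData_gradH_nonneg) (key 0 ⟨0, P.hd⟩ ⟨0, P.hd⟩ default default))
  exact ⟨δ, M, hδ, hM0, key⟩

/-! ## §4  The kernel hypothesis `hK` of `BIJ88Ineq217GradKernel` from the (7.2.2) bounds -/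

/-- **`hK` from the gradient member of (7.2.2) with explicit constants**: if `|∇H_{k,μν}(x, y)| ≤ M₀e^{−δ|x − y|}` (`|x − y|` = the
fine-site distance `distEU` in the unit of `T₁^{(k)}`), then `|(∂^{η⁻¹}H_ke_b)(p)| ≤ 2M₀e^{δ/2}·e^{−(δ/d)|x_k(p) − b₋|₁}` — §2 and
`|x_k − y|₁ ≤ d|x_k − y|_∞ ≤ d(|x − y| + ½)` (`B3TorusRadialSums.tdist_le_mul_supDist`, `BIJ85Ineq724Torus.supDist_blk_le_distEU`).
[cite: BalabanImbrieJaffe1985, (7.2.2) p.325] -/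
theorem hK_of_kernelBounds {k : ℕ} (hk : k ≤ P.m + P.K) {c : ℝ} (hc : c ≠ 0) {w : ℝ} (hw : 0 < w) {a : ℝ} (ha : 0 < a)
    {BondU : Type} {distEB : TSite P 0 → BondU → ℝ} {Cker : Fin P.d → Fin P.d → TSite P k → TSite P k → ℝ}
    {Dker : TSite P 0 → BondU → ℝ} {δ M₀ : ℝ} (hδ : 0 ≤ δ) (hM₀ : 0 ≤ M₀)
    (hB : ∀ (μ ν : Fin P.d) (x : TSite P 0) (y : TSite P k),
      (torusKernelData P k (deltaAData hk a) BondU distEB Cker Dker).gradH μ ν x y ≤ M₀ * Real.exp (-(δ * distEU P k x y)))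
    (p : TPlaq P 0) (b : PBond P k) :
    |curl ((P.L : ℝ) ^ k) (WithLp.ofLp (HkE P w c k (toEj P k (Pi.single b 1)))) p| ≤
      2 * M₀ * Real.exp (δ / 2) * Real.exp (-(δ / P.d) * ((blk k p.src).tdist b.src : ℝ)) := by
  have hd0 : (0 : ℝ) < P.d := by exact_mod_cast P.hd
  have h1 := abs_curl_HkE_single_le_gradH hk hc hw ha BondU distEB Cker Dker b p
  have h2 := hB p.ν b.dir p.src b.src
  have h3 := hB p.μ b.dir p.src b.src
  have ht : ((blk k p.src).tdist b.src : ℝ) ≤ P.d * (distEU P k p.src b.src + 1 / 2) := by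
    have h4 : ((blk k p.src).tdist b.src : ℝ) ≤ P.d * (supDist (blk k p.src) b.src : ℝ) := by
      exact_mod_cast tdist_le_mul_supDist (blk k p.src) b.src
    exact h4.trans (mul_le_mul_of_nonneg_left (supDist_blk_le_distEU hk p.src b.src) hd0.le)
  have hexp : Real.exp (-(δ * distEU P k p.src b.src)) ≤
      Real.exp (δ / 2) * Real.exp (-(δ / P.d) * ((blk k p.src).tdist b.src : ℝ)) := by
    rw [← Real.exp_add]
    refine Real.exp_le_exp.2 ?_
    have h5 : δ / P.d * ((blk k p.src).tdist b.src : ℝ) ≤ δ * (distEU P k p.src b.src + 1 / 2) :=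
      calc δ / P.d * ((blk k p.src).tdist b.src : ℝ)
          ≤ δ / P.d * (P.d * (distEU P k p.src b.src + 1 / 2)) := mul_le_mul_of_nonneg_left ht (div_nonneg hδ hd0.le)
        _ = δ * (distEU P k p.src b.src + 1 / 2) := by rw [← mul_assoc, div_mul_cancel₀ _ hd0.ne']
    linarith
  calc |curl ((P.L : ℝ) ^ k) (WithLp.ofLp (HkE P w c k (toEj P k (Pi.single b 1)))) p|
      ≤ _ := h1
    _ ≤ M₀ * Real.exp (-(δ * distEU P k p.src b.src)) + M₀ * Real.exp (-(δ * distEU P k p.src b.src)) := add_le_add h2 h3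
    _ = 2 * M₀ * Real.exp (-(δ * distEU P k p.src b.src)) := by ring
    _ ≤ 2 * M₀ * (Real.exp (δ / 2) * Real.exp (-(δ / P.d) * ((blk k p.src).tdist b.src : ℝ))) :=
        mul_le_mul_of_nonneg_left hexp (by positivity)
    _ = _ := by ring

/-- **`hK` at every scale of the family from the typed (7.2.2)**: `∃ M ≥ 0, δ_H > 0` with `|(∂^{η⁻¹}H_ke_b)(p)| ≤ Me^{−δ_H|x_k(p) − b₋|₁}` for
every scale `k = lev j` (any `w > 0`, `c ≠ 0` in `HkE`), `M = 2M(0)e^{δ/2}`, `δ_H = δ/d`. [cite: BalabanImbrieJaffe1985, (7.2.2) p.325] -/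
theorem exists_hK_of_ineq722 {lev : ℕ → ℕ} (hlev : ∀ j, lev j ≤ P.m + P.K) {a : ℝ} (ha : 0 < a) {BondU : ℕ → Type}
    {distEB : (j : ℕ) → TSite P 0 → BondU j → ℝ} {Cker : (j : ℕ) → Fin P.d → Fin P.d → TSite P (lev j) → TSite P (lev j) → ℝ}
    {Dker : (j : ℕ) → TSite P 0 → BondU j → ℝ}
    (h722 : KernelData.Ineq722
      (fun j => torusKernelData P (lev j) (deltaAData (hlev j) a) (BondU j) (distEB j) (Cker j) (Dker j))) :
    ∃ M δH : ℝ, 0 ≤ M ∧ 0 < δH ∧ ∀ (j : ℕ) (c : ℝ), c ≠ 0 → ∀ (w : ℝ), 0 < w → ∀ (p : TPlaq P 0) (b : PBond P (lev j)),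
      |curl ((P.L : ℝ) ^ lev j) (WithLp.ofLp (HkE P w c (lev j) (toEj P (lev j) (Pi.single b 1)))) p| ≤
        M * Real.exp (-δH * ((blk (lev j) p.src).tdist b.src : ℝ)) := by
  obtain ⟨δ, M₀, hδ, hM₀, hB⟩ := exists_bound_of_ineq722 hlev h722
  have hd0 : (0 : ℝ) < P.d := by exact_mod_cast P.hd
  refine ⟨2 * M₀ * Real.exp (δ / 2), δ / P.d, by positivity, div_pos hδ hd0, ?_⟩
  intro j c hc w hw p b
  exact hK_of_kernelBounds (hlev j) hc hw ha hδ.le hM₀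
    (fun μ ν x y => (le_add_of_nonneg_left (abs_nonneg _)).trans (hB j μ ν x y)) p b

/-! ## §5  (2.17) on the tori from (2.16) and the typed (7.2.2) -/

/-- **(2.17) ON THE TORUS AT ONE SCALE, EXPLICIT CONSTANTS, from (2.16) and the gradient member of (7.2.2)**: for p30's `σ_k = sigmaTorus hd
η^d η⁻¹ k`, `f = ∂A` on the box of radius `R` about `p₁.src = castSite z₁` (`2R < sitesPerDir k`), (2.16) for the kernel of σ_k beyond `R`
(`h216`, row sum `S`) and `|∇H_{k,μν}(x, y)| ≤ M₀e^{−δ₇|x − y|}` for p09's torus carrier (`hB`): `|(σ_kf)(p₁)| ≤ (2M₀e^{δ₇/2}·d(2(1 +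
(δ₇/d)⁻¹))^d·(d−1)·2R + c₀S(1 + 8(d−1)R))·‖f‖_∞`. [cite: BalabanImbrieJaffe1988, (2.17) p.262] -/
theorem abs_ineq217_kernelBounds_torus (hd : 2 ≤ P.d) {k : ℕ} (hk : k ≤ P.m + P.K) {a : ℝ} (ha : 0 < a)
    {BondU : Type} {distEB : TSite P 0 → BondU → ℝ} {Cker : Fin P.d → Fin P.d → TSite P k → TSite P k → ℝ}
    {Dker : TSite P 0 → BondU → ℝ} {δ₇ M₀ c₀ δ S : ℝ} (hδ₇ : 0 < δ₇) (hM₀ : 0 ≤ M₀) (hc₀ : 0 ≤ c₀)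
    (hB : ∀ (μ ν : Fin P.d) (x : TSite P 0) (y : TSite P k),
      (torusKernelData P k (deltaAData hk a) BondU distEB Cker Dker).gradH μ ν x y ≤ M₀ * Real.exp (-(δ₇ * distEU P k x y)))
    {R : ℕ} (hR : 2 * R < P.sitesPerDir k) {p₁ : TPlaq P k} {z₁ : Fin P.d → ℤ} (h₁ : p₁.src = castSite z₁)
    (h216 : ∀ p₂, (R : ℝ) ≤ pdist p₁ p₂ →
      |sigmaTorus (P := P) hd ((P.eta k) ^ P.d) ((P.L : ℝ) ^ k) k (toU P k (Pi.single p₂ 1)) p₁| ≤ c₀ * Real.exp (-δ * pdist p₁ p₂))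
    (hS : ∑ p₂, Real.exp (-δ * pdist p₁ p₂) ≤ S)
    {f : TPlaq P k → ℝ} {A : VecField P k ℝ} (hf : ∀ p ∈ boxPlaqs (loOf z₁ R) (hiOf z₁ R), f p = curl 1 A p) :
    |sigmaTorus (P := P) hd ((P.eta k) ^ P.d) ((P.L : ℝ) ^ k) k (toU P k f) p₁| ≤
      (2 * M₀ * Real.exp (δ₇ / 2) * ((P.d : ℝ) * (2 * (1 + (δ₇ / P.d)⁻¹)) ^ P.d) * (((P.d - 1 : ℕ) : ℝ) * (2 * R : ℕ)) +
        c₀ * S * (1 + 8 * ((P.d - 1 : ℕ) : ℝ) * R)) * supNorm f := by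
  have hd0 : (0 : ℝ) < P.d := by exact_mod_cast P.hd
  have hL : ((P.L : ℝ) ^ k) ≠ 0 := pow_ne_zero _ P.cast_L_pos.ne'
  exact abs_ineq217_gradKernel_torus_eta hd hk (by positivity) (div_pos hδ₇ hd0) hc₀
    (fun p b => hK_of_kernelBounds hk hL (pow_pos (eta_pos P k) _) ha hδ₇.le hM₀ hB p b) hR h₁ h216 hS hf

/-- **(2.17) ON THE TORI FROM (2.16) AND THE TYPED ROW C1.Eq7.2.1-7.2.2**: given r15's typed (7.2.2) `KernelData.Ineq722` for p09's torus
kernel family `j ↦ torusKernelData P (lev j) (deltaAData …) …` (scales `lev j ≤ m + K`), there is ONE constant `C₁ ≥ 0` such that AT EVERY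
SCALE `k = lev j`: for p30's `σ_k = sigmaTorus hd η^d η⁻¹ k`, every box radius `R` (`2R < sitesPerDir k`), every `p₁` (`p₁.src = castSite
z₁`), (2.16) for the kernel of σ_k beyond `R` at `p₁` (constant `c₀ ≥ 0`, rate `δ`, row sum `S`) and every `f = ∂A` on the box,
`|(σ_kf)(p₁)| ≤ (C₁(d−1)2R + c₀S(1 + 8(d−1)R))·‖f‖_∞` — p. 262's argument with its near part («σ_k is a bounded operator on curls [2]»)
supplied by [I] (7.2.1)–(7.2.2) (`exists_hK_of_ineq722` into `BIJ88Ineq217GradKernel.abs_ineq217_gradKernel_torus_eta`).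
[cite: BalabanImbrieJaffe1988, (2.17) p.262] -/
theorem abs_ineq217_ineq722_torus (hd : 2 ≤ P.d) {lev : ℕ → ℕ} (hlev : ∀ j, lev j ≤ P.m + P.K) {a : ℝ} (ha : 0 < a)
    {BondU : ℕ → Type} {distEB : (j : ℕ) → TSite P 0 → BondU j → ℝ}
    {Cker : (j : ℕ) → Fin P.d → Fin P.d → TSite P (lev j) → TSite P (lev j) → ℝ} {Dker : (j : ℕ) → TSite P 0 → BondU j → ℝ}
    (h722 : KernelData.Ineq722
      (fun j => torusKernelData P (lev j) (deltaAData (hlev j) a) (BondU j) (distEB j) (Cker j) (Dker j))) :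
    ∃ C₁ : ℝ, 0 ≤ C₁ ∧ ∀ (j : ℕ) (c₀ δ S : ℝ), 0 ≤ c₀ → ∀ (R : ℕ), 2 * R < P.sitesPerDir (lev j) →
      ∀ (p₁ : TPlaq P (lev j)) (z₁ : Fin P.d → ℤ), p₁.src = castSite z₁ →
      (∀ p₂, (R : ℝ) ≤ pdist p₁ p₂ →
        |sigmaTorus (P := P) hd ((P.eta (lev j)) ^ P.d) ((P.L : ℝ) ^ lev j) (lev j) (toU P (lev j) (Pi.single p₂ 1)) p₁| ≤
          c₀ * Real.exp (-δ * pdist p₁ p₂)) →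
      ∑ p₂, Real.exp (-δ * pdist p₁ p₂) ≤ S →
      ∀ (f : TPlaq P (lev j) → ℝ) (A : VecField P (lev j) ℝ), (∀ p ∈ boxPlaqs (loOf z₁ R) (hiOf z₁ R), f p = curl 1 A p) →
        |sigmaTorus (P := P) hd ((P.eta (lev j)) ^ P.d) ((P.L : ℝ) ^ lev j) (lev j) (toU P (lev j) f) p₁| ≤
          (C₁ * (((P.d - 1 : ℕ) : ℝ) * (2 * R : ℕ)) + c₀ * S * (1 + 8 * ((P.d - 1 : ℕ) : ℝ) * R)) * supNorm f := by
  obtain ⟨M, δH, hM, hδH, hK⟩ := exists_hK_of_ineq722 hlev ha h722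
  refine ⟨M * ((P.d : ℝ) * (2 * (1 + δH⁻¹)) ^ P.d), by positivity, ?_⟩
  intro j c₀ δ S hc₀ R hR p₁ z₁ h₁ h216 hS f A hf
  exact abs_ineq217_gradKernel_torus_eta hd (hlev j) hM hδH hc₀
    (fun p b => hK j _ (pow_ne_zero _ P.cast_L_pos.ne') _ (pow_pos (eta_pos P (lev j)) _) p b) hR h₁ h216 hS hf

/-- **(2.17) ON THE TORI GIVEN ONLY (2.16) AND [6I] PROPOSITION 1.2 BY ITS TREE NAME**: the same conclusion from `B5.Prop12Printed` for the
torus carriers `settingOf (torusRep P (lev j) (deltaAData …)) j` — row C1.Eq7.2.1-7.2.2's own derivation *"(7.2.2) is a consequence of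
Proposition 1.2 and the representation (1.103) of [6I]"* on the torus (`BIJ85Ineq722DeltaA.ineq722_deltaA_of_prop12Printed`) feeding
`abs_ineq217_ineq722_torus`. [cite: BalabanImbrieJaffe1988, (2.17) p.262] -/
theorem abs_ineq217_prop12_torus (hd : 2 ≤ P.d) {lev : ℕ → ℕ} (hlev : ∀ j, lev j ≤ P.m + P.K) {a : ℝ} (ha : 0 < a)
    (h12 : B5.Prop12Printed (fun j => settingOf (torusRep P (lev j) (deltaAData (hlev j) a)) j)) :
    ∃ C₁ : ℝ, 0 ≤ C₁ ∧ ∀ (j : ℕ) (c₀ δ S : ℝ), 0 ≤ c₀ → ∀ (R : ℕ), 2 * R < P.sitesPerDir (lev j) →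
      ∀ (p₁ : TPlaq P (lev j)) (z₁ : Fin P.d → ℤ), p₁.src = castSite z₁ →
      (∀ p₂, (R : ℝ) ≤ pdist p₁ p₂ →
        |sigmaTorus (P := P) hd ((P.eta (lev j)) ^ P.d) ((P.L : ℝ) ^ lev j) (lev j) (toU P (lev j) (Pi.single p₂ 1)) p₁| ≤
          c₀ * Real.exp (-δ * pdist p₁ p₂)) →
      ∑ p₂, Real.exp (-δ * pdist p₁ p₂) ≤ S →
      ∀ (f : TPlaq P (lev j) → ℝ) (A : VecField P (lev j) ℝ), (∀ p ∈ boxPlaqs (loOf z₁ R) (hiOf z₁ R), f p = curl 1 A p) →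
        |sigmaTorus (P := P) hd ((P.eta (lev j)) ^ P.d) ((P.L : ℝ) ^ lev j) (lev j) (toU P (lev j) f) p₁| ≤
          (C₁ * (((P.d - 1 : ℕ) : ℝ) * (2 * R : ℕ)) + c₀ * S * (1 + 8 * ((P.d - 1 : ℕ) : ℝ) * R)) * supNorm f :=
  abs_ineq217_ineq722_torus hd hlev ha
    (ineq722_deltaA_of_prop12Printed lev hlev ha (fun _ => PUnit) (fun _ _ _ => 0) (fun _ _ _ _ _ => 0) (fun _ _ _ => 0) h12)

end

end Literature.MathematicalPhysics.QuantumFieldTheory.BalabanImbrieJaffe1984to88.BIJ88Ineq217Ineq722Torus
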